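import Summits.Schanuel.Schanuel.Theorems.ZilberEacBoundedBranchGeneral
import Summits.Schanuel.Schanuel.Theorems.ZilberEacBranchPolarForm
import Literature.ModelTheory.Zilber.EACDensityTransport
import HarnessLib

/-!
# Arbitrary base branches, LXVIII (b): ASYMPTOTES OF RATIONAL SLOPE — density by transport to a
# bounded branch, with NO direction condition

HONEST FRAMING.  Cell `pub-schanuel` (Zilber's Exponential-Algebraic Closedness, case ladder;
host summit Schanuel), seat 2, gen 31.  The growth method is silent along a branch at infinity
of the base curve `C : F(x₀, x₁) = 0` asymptotic to a direction of RATIONAL slope (`x₁ ~ (p/q)x₀`: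
`Re((p/q)·2πi) = 0`).  If the branch is asymptotic to a LINE of rational slope —
`q x₁ − p x₀ → c` finite along it, the generic behaviour at a smooth point at infinity — then the
lattice change of coordinates `x' = U x`, `y' = y^U` (`U = (a b; -p q) ∈ SL₂(ℤ)`), which preserves
the exponential graph and Zariski density (tree: `unprojectedDense_latticeClosure_iff`), carries the
exponential points `(x, e^{x})` of the surface near the branch to points of the transported surface
`S^U` whose coordinate `x₁' = q x₁ − p x₀` is BOUNDED and whose `y₁' = e^{x₁'}` is an analytic
function of the place parameter; THEOREM T applies on `S^U` with the transcendence supplied by the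
bounded-branch lemma of file LXVIII (a) for the transported curve `C' = U C` (irreducible, no
horizontal line since `C` lies on no line).  Result: **`unprojectedDense_rationalAsymptote`** — `F`
irreducible of `x₁`-degree `≥ 2`; `U ∈ SL₂(ℤ)` (with inverse `V`), `U₁₁ ≠ 0`; a place
`x₀ = s^{-k}`, `x₁ = X₁(s)` of `C` with `U₁₀ x₀ + U₁₁ x₁ = γ(s)` ANALYTIC at `0`; a fibre value
`ψ(s)s^L`, `ψ(0) ≠ 0`: every irreducible `S` of dimension `≤ 2` containing the germ
`(x₀, x₁, ψ s^L, e^{x₁})` has Zariski-dense exponential points — NO direction condition; and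
**`unprojectedDensityQuestion_planeCurve_polyFibre_rationalAsymptote`** (`{F = 0, y₀ = R}`: case
∧ dense).  Decided instances of an OPEN question (Mantova–Masser, PLMS 2024 §1 p. 5); EC(3,2) OPEN;
NOT Schanuel's conjecture (neither used nor implied); EAC ⇏ SC.
-/

noncomputable section

open Filter Topology Set Complex Polynomial
open Literature.NumberTheory.Transcendental Literature.ModelTheory.Zilber
open Literature.ModelTheory.ExponentialFields

set_option linter.dupNamespace false

namespace Summit.Schanuel.Schanuel.Theorems

section RationalAsymptote

variable (F : ℂ[X][X])

/-- `intLinMap` on `ℂ²` in coordinates. [folklore] -/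
theorem intLinMap_two (U : Matrix (Fin 2) (Fin 2) ℤ) (x : Fin 2 → ℂ) (i : Fin 2) :
    intLinMap U x i = (U i 0 : ℂ) * x 0 + (U i 1 : ℂ) * x 1 := by
  simp [intLinMap, Fin.sum_univ_two]

/-- **An irreducible curve of `x₁`-degree `≥ 2` contains no line `m₀x₀ + m₁x₁ = a` with
`m₁ ≠ 0`** (Bézout against the line's rows). [folklore] -/
theorem planeCurve_not_contains_line (hFirr : Irreducible F) (hn : 2 ≤ F.natDegree) (m₀ m₁ a : ℂ)
    (hm₁ : m₁ ≠ 0) : ∃ x₀ : ℂ, (F.map (Polynomial.evalRingHom x₀)).eval ((a - m₀ * x₀) / m₁) ≠ 0 := by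
  classical
  by_contra hall
  push Not at hall
  set Rl : ℂ[X][X] := C (C m₁) * X + C (C m₀ * X - C a) with hRl
  have hRl1 : Rl.natDegree ≤ 1 := Polynomial.natDegree_linear_le
  have hRl0 : Rl ≠ 0 := by
    intro h
    have h1 := congrArg (fun p : ℂ[X][X] => (p.coeff 1).coeff 0) h
    simp only [hRl, Polynomial.coeff_add, Polynomial.coeff_C_mul, Polynomial.coeff_X_one, mul_one,
      Polynomial.coeff_C_succ, add_zero, Polynomial.coeff_C_zero, Polynomial.coeff_zero] at h1
    exact hm₁ h1
  obtain ⟨Uu, Vv, D, hD, hUV⟩ := exists_bezout_of_irreducible' F Rl hFirr (by omega) hRl0 (by omega)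
  apply hD
  refine Polynomial.funext fun x₀ => ?_
  set y : ℂ := (a - m₀ * x₀) / m₁ with hy
  have hFy : (F.map (Polynomial.evalRingHom x₀)).eval y = 0 := by rw [hy]; exact hall x₀
  have hRl_eval : (Rl.map (Polynomial.evalRingHom x₀)).eval y = 0 := by
    simp only [hRl, Polynomial.map_add, Polynomial.map_mul, Polynomial.map_C, Polynomial.map_X,
      Polynomial.eval_add, Polynomial.eval_mul, Polynomial.eval_sub, Polynomial.eval_C,
      Polynomial.eval_X, Polynomial.coe_evalRingHom, hy]
    field_simp
    ring
  have h := congrArg (fun G : ℂ[X][X] => (G.map (Polynomial.evalRingHom x₀)).eval y) hUV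
  simp only [Polynomial.map_add, Polynomial.map_mul, Polynomial.eval_add, Polynomial.eval_mul, hFy,
    hRl_eval, mul_zero, add_zero, Polynomial.map_C, Polynomial.eval_C, Polynomial.coe_evalRingHom] at h
  rw [Polynomial.eval_zero]
  exact h.symm

/-- **THEOREM (asymptotes of rational slope).**  See the module docstring.
[cite: MantovaMasser2023, §1 Further remarks, p. 5 (the question, open in general)] (new) -/
theorem unprojectedDense_rationalAsymptote {S : Set (Fin 2 ⊕ Fin 2 → ℂ)} (hS : IsIrreducibleClosed ℂ S)
    (hdim : zariskiDim ℂ S ≤ (2 : ℕ)) (hFirr : Irreducible F) (hn : 2 ≤ F.natDegree)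
    (U V : Matrix (Fin 2) (Fin 2) ℤ) (hUV : U * V = 1) (hVU : V * U = 1) (hq : U 1 1 ≠ 0)
    {k : ℕ} (hk : 1 ≤ k) {X₁ γ : ℂ → ℂ} (hγan : AnalyticAt ℂ γ 0)
    (hγ : ∀ᶠ s in 𝓝[≠] (0 : ℂ), (U 1 0 : ℂ) * (s ^ k)⁻¹ + (U 1 1 : ℂ) * X₁ s = γ s)
    (hplace : ∀ᶠ s in 𝓝[≠] (0 : ℂ), (F.map (Polynomial.evalRingHom (s ^ k)⁻¹)).eval (X₁ s) = 0)
    (L : ℤ) {ψ : ℂ → ℂ} (hψan : AnalyticAt ℂ ψ 0) (hψ0 : ψ 0 ≠ 0)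
    (hgerm : ∀ᶠ s in 𝓝[≠] (0 : ℂ),
      (Sum.elim ![(s ^ k)⁻¹, X₁ s] ![ψ s * s ^ L, Complex.exp (X₁ s)] : Fin 2 ⊕ Fin 2 → ℂ) ∈ S) :
    UnprojectedDense S := by
  classical
  have hk0 : k ≠ 0 := by omega
  have hqC : (U 1 1 : ℂ) ≠ 0 := by exact_mod_cast hq
  -- the determinant
  have hdet : (U 0 0 : ℂ) * (U 1 1 : ℂ) - (U 0 1 : ℂ) * (U 1 0 : ℂ) ≠ 0 := by
    have h1 : U.det * V.det = 1 := by rw [← Matrix.det_mul, hUV, Matrix.det_one]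
    have h2 : U.det ≠ 0 := fun h => by rw [h, zero_mul] at h1; exact zero_ne_one h1
    rw [Matrix.det_fin_two] at h2
    exact_mod_cast h2
  -- the leading coefficient of `x₀'` along the place
  set U₀ : ℂ → ℂ := fun s => (U 0 0 : ℂ) + (U 0 1 : ℂ) * ((γ s * s ^ k - (U 1 0 : ℂ)) / (U 1 1 : ℂ))
    with hU₀
  have hU₀an : AnalyticAt ℂ U₀ 0 := by
    rw [hU₀]
    exact analyticAt_const.add (analyticAt_const.mul
      (((hγan.mul (analyticAt_id.pow k)).sub analyticAt_const).div_const))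
  have hU₀val : U₀ 0 = ((U 0 0 : ℂ) * (U 1 1 : ℂ) - (U 0 1 : ℂ) * (U 1 0 : ℂ)) / (U 1 1 : ℂ) := by
    rw [hU₀]
    simp only [zero_pow hk0, mul_zero, zero_sub]
    field_simp
    ring
  have hU₀0 : U₀ 0 ≠ 0 := by rw [hU₀val]; exact div_ne_zero hdet hqC
  -- `x₀' = U₀(s) s^{-k}` and `x₁' = γ(s)` along the place
  have hcoord : ∀ᶠ s in 𝓝[≠] (0 : ℂ),
      (U 0 0 : ℂ) * (s ^ k)⁻¹ + (U 0 1 : ℂ) * X₁ s = U₀ s * s⁻¹ ^ k ∧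
      (U 1 0 : ℂ) * (s ^ k)⁻¹ + (U 1 1 : ℂ) * X₁ s = γ s := by
    filter_upwards [hγ, self_mem_nhdsWithin] with s hs (hs0 : s ≠ 0)
    refine ⟨?_, hs⟩
    have hX : X₁ s = (γ s - (U 1 0 : ℂ) * (s ^ k)⁻¹) / (U 1 1 : ℂ) := by
      rw [← hs]
      field_simp
      ring
    rw [hX, hU₀, inv_pow]
    have hsk : s ^ k ≠ 0 := pow_ne_zero _ hs0
    field_simp
  -- exponential points along the germ
  obtain ⟨z, hz⟩ := IsAlgClosed.exists_pow_nat_eq (2 * Real.pi * I : ℂ) (by omega : 0 < k)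
  obtain ⟨N₀, u, s, -, -, -, -, -, -, -, -, hs0, hs, hexp⟩ := exists_poleFibre_expPoints hk L hψan hψ0 hz
  have hsW : Tendsto s atTop (𝓝[≠] (0 : ℂ)) :=
    tendsto_nhdsWithin_iff.2 ⟨hs, Eventually.of_forall hs0⟩
  obtain ⟨J₀, hJ₀⟩ := Filter.eventually_atTop.1 (hsW.eventually (hgerm.and hcoord))
  set p : ℕ → Fin 2 ⊕ Fin 2 → ℂ := fun m =>
    Sum.elim ![(s (J₀ + m) ^ k)⁻¹, X₁ (s (J₀ + m))]
      ![ψ (s (J₀ + m)) * s (J₀ + m) ^ L, Complex.exp (X₁ (s (J₀ + m)))] with hp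
  have hpS : ∀ m, p m ∈ S := fun m => (hJ₀ (J₀ + m) (Nat.le_add_right _ _)).1
  have hpc : ∀ m, (U 0 0 : ℂ) * (s (J₀ + m) ^ k)⁻¹ + (U 0 1 : ℂ) * X₁ (s (J₀ + m)) =
      U₀ (s (J₀ + m)) * (s (J₀ + m))⁻¹ ^ k ∧
      (U 1 0 : ℂ) * (s (J₀ + m) ^ k)⁻¹ + (U 1 1 : ℂ) * X₁ (s (J₀ + m)) = γ (s (J₀ + m)) :=
    fun m => (hJ₀ (J₀ + m) (Nat.le_add_right _ _)).2
  have hpΓ : ∀ m, p m ∈ expGraph ℂ 2 := by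
    intro m
    rw [mem_expGraph_iff]
    intro i
    rw [Literature.ModelTheory.ExponentialFields.ExponentialRing.complex_exp_eq]
    fin_cases i
    · simp [hp, hexp (J₀ + m)]
    · simp [hp]
  have hpT : ∀ m, p m ∈ torusLocus ℂ 2 := fun m => expGraph_subset_torusLocus (hpΓ m)
  have hne : (S ∩ torusLocus ℂ 2).Nonempty := ⟨p 0, hpS 0, hpT 0⟩
  -- the transported surface and points
  set S' : Set (Fin 2 ⊕ Fin 2 → ℂ) := latticeClosure U S with hS'
  have hS'irr : IsIrreducibleClosed ℂ S' := isIrreducibleClosed_latticeClosure U hS hne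
  have hS'dim : zariskiDim ℂ S' ≤ (2 : ℕ) := by
    rw [hS', zariskiDim_latticeClosure hUV hVU hS hne]; exact hdim
  set p' : ℕ → Fin 2 ⊕ Fin 2 → ℂ := fun m => latticeChange U (p m) with hp'
  have hp'S : ∀ m, p' m ∈ S' := fun m =>
    latticeImage_subset_latticeClosure U S ⟨p m, ⟨hpS m, hpT m⟩, rfl⟩
  have hp'Γ : ∀ m, p' m ∈ expGraph ℂ 2 := fun m => latticeChange_mem_expGraph (hpΓ m)
  have hp'x₀ : ∀ m, p' m (Sum.inl 0) = U₀ (s (J₀ + m)) * (s (J₀ + m))⁻¹ ^ k := by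
    intro m
    change latticeChange U (p m) (Sum.inl 0) = _
    rw [latticeChange_inl, intLinMap_two]
    simp only [projAdd, hp, Sum.elim_inl, Matrix.cons_val_zero, Matrix.cons_val_one]
    exact (hpc m).1
  have hp'x₁ : ∀ m, p' m (Sum.inl 1) = γ (s (J₀ + m)) := by
    intro m
    change latticeChange U (p m) (Sum.inl 1) = _
    rw [latticeChange_inl, intLinMap_two]
    simp only [projAdd, hp, Sum.elim_inl, Matrix.cons_val_zero, Matrix.cons_val_one]
    exact (hpc m).2
  have hp'y₁ : ∀ m, p' m (Sum.inr 1) = Complex.exp (γ (s (J₀ + m))) := by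
    intro m
    have h := (mem_expGraph_iff.1 (hp'Γ m)) 1
    rw [Literature.ModelTheory.ExponentialFields.ExponentialRing.complex_exp_eq, hp'x₁] at h
    exact h
  have hsJ : Tendsto (fun m => s (J₀ + m)) atTop (𝓝 0) :=
    hs.comp ((tendsto_add_atTop_nat J₀).congr fun m => by ring)
  have hsJ0 : ∀ m, s (J₀ + m) ≠ 0 := fun m => hs0 _
  have hnorm : Tendsto (fun m => ‖p' m (Sum.inl 0)‖) atTop atTop := by
    have h1 : Tendsto (fun m => ‖(s (J₀ + m))⁻¹ ^ k‖) atTop atTop := by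
      have h0 : Tendsto (fun m => ‖s (J₀ + m) ^ k‖) atTop (𝓝[>] 0) := by
        refine tendsto_nhdsWithin_iff.2 ⟨?_, Eventually.of_forall fun m => ?_⟩
        · have h00 : Tendsto (fun m => s (J₀ + m) ^ k) atTop (𝓝 0) := by
            simpa [zero_pow hk0] using hsJ.pow k
          simpa using h00.norm
        · exact norm_pos_iff.2 (pow_ne_zero _ (hsJ0 m))
      refine (tendsto_inv_nhdsGT_zero.comp h0).congr fun m => ?_
      simp [norm_inv, inv_pow]
    have h2 : Tendsto (fun m => ‖U₀ (s (J₀ + m))‖) atTop (𝓝 ‖U₀ 0‖) :=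
      (hU₀an.continuousAt.tendsto.comp hsJ).norm
    refine ((h2.pos_mul_atTop (norm_pos_iff.2 hU₀0)) h1).congr fun m => ?_
    rw [hp'x₀, norm_mul]
  have hdense' : UnprojectedDense S' := by
    refine unprojectedDense_of_transcendental_relation_pole hS'irr hS'dim 0 1 hp'S hp'Γ hnorm
      hU₀an hγan.cexp k hsJ0 hsJ hp'x₀ hp'y₁ ?_
    -- transcendence along the transported (bounded) branch
    intro H hH0 hrel
    obtain ⟨Φr, hΦr⟩ := exists_rowsEquiv
    set A : MvPolynomial (Fin 2) ℂ := Φr.symm F with hA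
    have hPQ : ∀ x y : ℂ, MvPolynomial.eval ![x, y] A = (F.map (Polynomial.evalRingHom x)).eval y := by
      intro x y
      rw [hΦr, hA, RingEquiv.apply_symm_apply]
    have hirrA : Irreducible A := (irreducible_rows_iff hPQ).2 hFirr
    set A' : MvPolynomial (Fin 2) ℂ := linSubst V A with hA'
    have hirrA' : Irreducible A' := by
      have h := (MulEquiv.irreducible_iff (linSubstEquiv (K := ℂ) hVU hUV)).2 hirrA
      rwa [linSubstEquiv_apply] at h
    set F' : ℂ[X][X] := Φr A' with hF'
    have hPQ' : ∀ x y : ℂ, MvPolynomial.eval ![x, y] A' = (F'.map (Polynomial.evalRingHom x)).eval y :=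
      fun x y => hΦr A' x y
    have hF'irr : Irreducible F' := (irreducible_rows_iff hPQ').1 hirrA'
    have hF'ev : ∀ x y : ℂ, (F'.map (Polynomial.evalRingHom x)).eval y =
        (F.map (Polynomial.evalRingHom ((V 0 0 : ℂ) * x + (V 0 1 : ℂ) * y))).eval
          ((V 1 0 : ℂ) * x + (V 1 1 : ℂ) * y) := by
      intro x y
      have hv : intLinMap V ![x, y] = ![(V 0 0 : ℂ) * x + (V 0 1 : ℂ) * y, (V 1 0 : ℂ) * x + (V 1 1 : ℂ) * y] := by
        funext i
        fin_cases i
        · show intLinMap V _ 0 = _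
          rw [intLinMap_two]; simp
        · show intLinMap V _ 1 = _
          rw [intLinMap_two]; simp
      rw [← hPQ', hA', eval_linSubst, ← hPQ, hv]
    -- the transported place
    have hVU' : ∀ x : Fin 2 → ℂ, intLinMap V (intLinMap U x) = x :=
      intLinMap_intLinMap_of_mul_eq_one hVU
    have hplace' : ∀ᶠ u in 𝓝[≠] (0 : ℂ),
        (F'.map (Polynomial.evalRingHom (U₀ u * u⁻¹ ^ k))).eval (γ u) = 0 := by
      filter_upwards [hplace, hcoord] with u hu hc
      have hx : intLinMap U ![(u ^ k)⁻¹, X₁ u] = (![U₀ u * u⁻¹ ^ k, γ u] : Fin 2 → ℂ) := by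
        funext i
        fin_cases i
        · show intLinMap U _ 0 = _
          rw [intLinMap_two]; simpa using hc.1
        · show intLinMap U _ 1 = _
          rw [intLinMap_two]; simpa using hc.2
      rw [← hPQ', hA', eval_linSubst, ← hx, hVU', hPQ]
      exact hu
    -- `F'` has positive `x₁'`-degree
    have hU₀W : Tendsto (fun u : ℂ => ‖U₀ u * u⁻¹ ^ k‖) (𝓝[≠] (0 : ℂ)) atTop := by
      have h1 : Tendsto (fun u : ℂ => ‖u⁻¹ ^ k‖) (𝓝[≠] (0 : ℂ)) atTop := by
        have h0 : Tendsto (fun u : ℂ => u ^ k) (𝓝[≠] (0 : ℂ)) (𝓝[≠] 0) := by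
          refine tendsto_nhdsWithin_iff.2 ⟨?_, ?_⟩
          · have : Tendsto (fun u : ℂ => u ^ k) (𝓝 (0 : ℂ)) (𝓝 (0 ^ k)) :=
              (continuous_pow k).continuousAt.tendsto
            rw [zero_pow hk0] at this
            exact this.mono_left nhdsWithin_le_nhds
          · filter_upwards [self_mem_nhdsWithin] with u hu
            exact pow_ne_zero _ hu
        refine ((tendsto_norm_inv_nhdsNE_zero_atTop (α := ℂ)).comp h0).congr fun u => ?_
        simp [norm_inv, inv_pow]
      have h2 : Tendsto (fun u : ℂ => ‖U₀ u‖) (𝓝[≠] (0 : ℂ)) (𝓝 ‖U₀ 0‖) :=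
        (hU₀an.continuousAt.tendsto.mono_left nhdsWithin_le_nhds).norm
      refine ((h2.pos_mul_atTop (norm_pos_iff.2 hU₀0)) h1).congr fun u => ?_
      rw [norm_mul]
    have hF'1 : 1 ≤ F'.natDegree := by
      by_contra hlt
      push Not at hlt
      have hF'C := Polynomial.eq_C_of_natDegree_eq_zero (Nat.lt_one_iff.1 hlt)
      have hr : F'.coeff 0 = 0 := by
        by_contra hr0
        have hev := eventually_eval_ne_zero_of_tendsto_norm hr0 hU₀W
        obtain ⟨u, hu1, hu2⟩ := (hev.and hplace').exists
        apply hu1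
        rw [hF'C, Polynomial.map_C, Polynomial.eval_C, Polynomial.coe_evalRingHom] at hu2
        exact hu2
      have hF'0 : F' = 0 := by rw [hF'C, hr, map_zero]
      exact hF'irr.ne_zero hF'0
    -- `C'` contains no horizontal line (else `C` would contain the line `U₁₀x₀ + U₁₁x₁ = a`)
    have hF'h : ∀ a : ℂ, ∃ c : ℂ, (F'.map (Polynomial.evalRingHom c)).eval a ≠ 0 := by
      intro a
      obtain ⟨x₀, hx₀⟩ := planeCurve_not_contains_line F hFirr hn (U 1 0 : ℂ) (U 1 1 : ℂ) a hqC
      set x₁ : ℂ := (a - (U 1 0 : ℂ) * x₀) / (U 1 1 : ℂ) with hx₁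
      refine ⟨(U 0 0 : ℂ) * x₀ + (U 0 1 : ℂ) * x₁, ?_⟩
      have ha : a = (U 1 0 : ℂ) * x₀ + (U 1 1 : ℂ) * x₁ := by rw [hx₁]; field_simp; ring
      have hx : intLinMap U ![x₀, x₁] = (![(U 0 0 : ℂ) * x₀ + (U 0 1 : ℂ) * x₁, a] : Fin 2 → ℂ) := by
        funext i
        fin_cases i
        · show intLinMap U _ 0 = _
          rw [intLinMap_two]; simp
        · show intLinMap U _ 1 = _
          rw [intLinMap_two, ha]; simp
      rw [← hPQ', hA', eval_linSubst, ← hx, hVU', hPQ]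
      exact hx₀
    -- reparametrise `x₀' = U₀(u)u^{-k}` to `σ^{-k}`
    obtain ⟨lam, W, hlaman, hlam0, -, -, -, hlam⟩ := exists_polar_reparam hU₀an hU₀0 hk
    have hlamT : Tendsto lam (𝓝[≠] (0 : ℂ)) (𝓝[≠] 0) := by
      refine tendsto_nhdsWithin_iff.2 ⟨?_, hlam.mono fun σ h => h.1⟩
      have := hlaman.continuousAt.tendsto
      rw [hlam0] at this
      exact this.mono_left nhdsWithin_le_nhds
    have hγlam : AnalyticAt ℂ (fun σ => γ (lam σ)) 0 := by
      refine AnalyticAt.comp ?_ hlaman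
      rw [hlam0]; exact hγan
    have hplaceσ : ∀ᶠ σ in 𝓝[≠] (0 : ℂ),
        (F'.map (Polynomial.evalRingHom (σ ^ k)⁻¹)).eval (γ (lam σ)) = 0 := by
      filter_upwards [hlamT.eventually hplace', hlam] with σ h1 h2
      rw [← h2.2]
      rw [inv_pow] at h1
      exact h1
    have hrelσ : ∀ᶠ σ in 𝓝[≠] (0 : ℂ),
        (H.map (Polynomial.evalRingHom ((fun _ : ℂ => (1 : ℂ)) σ * σ⁻¹ ^ k))).eval
          (Complex.exp (γ (lam σ))) = 0 := by
      filter_upwards [hlamT.eventually hrel, hlam] with σ h1 h2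
      simp only [one_mul, inv_pow]
      rw [← h2.2]
      rw [inv_pow] at h1
      exact h1
    exact not_eventually_relation_exp_boundedBranch' F' hF'irr hF'1 hF'h hk hγlam hplaceσ H hH0 hrelσ
  exact (unprojectedDense_latticeClosure_iff hUV hVU hS hne).1 hdense'

/-- **Polynomial fibres along an asymptote of rational slope: case ∧ dense, no direction
condition.**  `F` irreducible of `x₁`-degree `≥ 2`; `U ∈ SL₂(ℤ)` with inverse `V` and `U₁₁ ≠ 0`;
a place `x₀ = s^{-k}`, `x₁ = X₁(s)` of the curve along which `U₁₀x₀ + U₁₁x₁` is analytic at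
`s = 0`; `R` nonzero somewhere on the curve. [cite: MantovaMasser2023, §1 Further remarks, p. 5
(the question, open in general)] (new) -/
theorem unprojectedDensityQuestion_planeCurve_polyFibre_rationalAsymptote (hFirr : Irreducible F)
    (hn : 2 ≤ F.natDegree) (U V : Matrix (Fin 2) (Fin 2) ℤ) (hUV : U * V = 1) (hVU : V * U = 1)
    (hq : U 1 1 ≠ 0) {k : ℕ} (hk : 1 ≤ k) {X₁ γ : ℂ → ℂ} (hγan : AnalyticAt ℂ γ 0)
    (hγ : ∀ᶠ s in 𝓝[≠] (0 : ℂ), (U 1 0 : ℂ) * (s ^ k)⁻¹ + (U 1 1 : ℂ) * X₁ s = γ s)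
    (hplace : ∀ᶠ s in 𝓝[≠] (0 : ℂ), (F.map (Polynomial.evalRingHom (s ^ k)⁻¹)).eval (X₁ s) = 0)
    (R : MvPolynomial (Fin 2) ℂ)
    (hR : ∃ x y : ℂ, (F.map (Polynomial.evalRingHom x)).eval y = 0 ∧ MvPolynomial.eval ![x, y] R ≠ 0) :
    MMCaseDimPiOneFree {w : Fin 2 ⊕ Fin 2 → ℂ |
        (F.map (Polynomial.evalRingHom (w (Sum.inl 0)))).eval (w (Sum.inl 1)) = 0 ∧
        w (Sum.inr 0) = MvPolynomial.eval ![w (Sum.inl 0), w (Sum.inl 1)] R} ∧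
      UnprojectedDense {w : Fin 2 ⊕ Fin 2 → ℂ |
        (F.map (Polynomial.evalRingHom (w (Sum.inl 0)))).eval (w (Sum.inl 1)) = 0 ∧
        w (Sum.inr 0) = MvPolynomial.eval ![w (Sum.inl 0), w (Sum.inl 1)] R} := by
  classical
  refine ⟨mmCase_planeCurve_polyFibre F hFirr hn R hR, ?_⟩
  obtain ⟨Φr, hΦr⟩ := exists_rowsEquiv
  set A : MvPolynomial (Fin 2) ℂ := Φr.symm F with hA
  have hPQ : ∀ x y : ℂ, MvPolynomial.eval ![x, y] A = (F.map (Polynomial.evalRingHom x)).eval y := by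
    intro x y
    rw [hΦr, hA, RingEquiv.apply_symm_apply]
  have hirrA : Irreducible A := (irreducible_rows_iff hPQ).2 hFirr
  have hset : {w : Fin 2 ⊕ Fin 2 → ℂ |
      (F.map (Polynomial.evalRingHom (w (Sum.inl 0)))).eval (w (Sum.inl 1)) = 0 ∧
      w (Sum.inr 0) = MvPolynomial.eval ![w (Sum.inl 0), w (Sum.inl 1)] R} =
      {w : Fin 2 ⊕ Fin 2 → ℂ | MvPolynomial.eval ![w (Sum.inl 0), w (Sum.inl 1)] A = 0 ∧
        w (Sum.inr 0) = MvPolynomial.eval ![w (Sum.inl 0), w (Sum.inl 1)] R} := by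
    ext w
    simp only [Set.mem_setOf_eq, hPQ]
  rw [hset]
  have hS := isIrreducibleClosed_curveGraphFibre R hirrA
  have hdim := zariskiDim_curveGraphFibre R hirrA
  have hndvd : ¬ F ∣ Φr R := by
    refine not_dvd_of_exists_eval_ne_zero F ?_
    obtain ⟨x, y, hxy, hne⟩ := hR
    exact ⟨x, y, hxy, by rw [← hΦr]; exact hne⟩
  -- the place in the normal-form lemma's format: `X₁ s` need not be `Φ(s)s^{-M}`; use the
  -- analytic normal form of the value along the chart `x₁ = X₁(s) = (X₁(s)s^0)·(s^0)⁻¹`? No: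
  -- `exists_rows_place_normalForm` wants `x₁ = Φ(s)(s^M)⁻¹` with `Φ` analytic; here
  -- `X₁(s) = (γ(s) - U₁₀ s^{-k})/U₁₁ = Φ(s)(s^k)⁻¹` with `Φ(s) = (γ(s)s^k - U₁₀)/U₁₁` analytic.
  have hqC : (U 1 1 : ℂ) ≠ 0 := by exact_mod_cast hq
  set Φ : ℂ → ℂ := fun s => (γ s * s ^ k - (U 1 0 : ℂ)) / (U 1 1 : ℂ) with hΦ
  have hΦan : AnalyticAt ℂ Φ 0 := ((hγan.mul (analyticAt_id.pow k)).sub analyticAt_const).div_const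
  have hX₁Φ : ∀ᶠ s in 𝓝[≠] (0 : ℂ), X₁ s = Φ s * (s ^ k)⁻¹ := by
    filter_upwards [hγ, self_mem_nhdsWithin] with s hs (hs0 : s ≠ 0)
    have hsk : s ^ k ≠ 0 := pow_ne_zero _ hs0
    show X₁ s = (γ s * s ^ k - (U 1 0 : ℂ)) / (U 1 1 : ℂ) * (s ^ k)⁻¹
    rw [← hs]
    field_simp
    ring
  have hplaceΦ : ∀ᶠ s in 𝓝[≠] (0 : ℂ),
      (F.map (Polynomial.evalRingHom (s ^ k)⁻¹)).eval (Φ s * (s ^ k)⁻¹) = 0 := by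
    filter_upwards [hplace, hX₁Φ] with s hs hX
    rwa [hX] at hs
  obtain ⟨ψ, L, hψan, hψ0, hf⟩ :=
    exists_rows_place_normalForm F hFirr (by omega) (Φr R) hndvd hk k hΦan hplaceΦ
  refine unprojectedDense_rationalAsymptote F hS (le_of_eq hdim) hFirr hn U V hUV hVU hq hk hγan hγ
    hplace L hψan hψ0 ?_
  filter_upwards [hplace, hf, hX₁Φ] with s hs hfs hX
  refine ⟨?_, ?_⟩
  · simp only [Sum.elim_inl, Matrix.cons_val_zero, Matrix.cons_val_one]
    rw [hPQ]
    exact hs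
  · simp only [Sum.elim_inr, Sum.elim_inl, Matrix.cons_val_zero, Matrix.cons_val_one]
    rw [hΦr, hX, hfs]

end RationalAsymptote

end Summit.Schanuel.Schanuel.Theorems

end
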